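import Summits.QuantumFields.YangMills.Theorems.BalabanUVNodesN27AtReadingOfRecord13CoPH
import Summits.QuantumFields.YangMills.Theorems.BalabanUVNodesN16LinesAllTorusAtRecord13CoPH

/-!
# BalabanUVNodes ∕ N27 = binder B5 AT THE RECORD — XLᶜᵒᵖᴴ AT THE `CoPH`-KEYED STAGE-13 READING OF RECORD WITH N16 IN dag-n16's WINDOW-LINEAR CURRENCY (trigger (t2) of this seat: a
# producer face in a NEW currency at the v1.7 `CoPH` reading): the N16 slot of XLᶜᵒᵖᴴ `…N27AtReadingOfRecord13CoPH` (§1 ∕ §2 `_of_leafSlot`: `InEndRegime ∧ LeafSlot` once per family at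
# RR-1's constant layer) is REPLACED by dag-n16-e's LINE OF RECORD in the linear currency AT THE PINNED ALL-TORUS SUB-INDEX `s_N16_readingOfRecord₁₃CoPH_of_window_linear_allTorus` ∕
# `s_N16_readingOfRecord₁₃CoPHOn_of_window_linear_allTorus` (36ᴴ `…N16LinesAllTorusAtRecord13CoPH`, p545660), hypothesis VERBATIM: ONCE per (guarded) family, N05's [B8]
# `Thm4Body (c₁ F) (B₁' F) …` ∧ `Prop3Body (cP F) 4 L (C₂ F) (inp F) (B₀β F) …` on the PINNED ALL-TORUS proper sub-family `{i : ZdIdx 4 F.L // (∀ j, i.Ω j = univ) ∧ (Λs, Λb diagonal) ∧ i.η = (L⁻¹)^i.k}`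
# of the `Z^d` leaf model `zdGF3 (M_N ℂ) F.L 1 (len F)` (⊂ dag-n05-c's `IdxB8SubB`, F47 §1) and N07's `LeafH3sup 4 F.L (ne3NperOfRecord₁₁ F 0 0) (ℓ₃ F).ε (b' F) (c' F) (ne3DomOfRecord₁₁ F N 0 0)` — with
# the section's 21 LETTER LINES (`hlen … hc'`: N05's window `hwin`, the averaging letter `α F` below the five ceilings, N07's leaf letters, RR-1's radius ∕ constant of record) displayed as
# hypotheses.  NOT the univ-keyed edition (23ᴴ `…_of_window_linear`, whose `Thm4Body` on the law-free `Ω₀ = univ` sub-family is REFUTED by dag-n16-c F50 `not_thm4Printed_zdGF3_univ` when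
# `0 < c₁ F` — dag-n16-e g13 VACUITY-FLAG I.22020 on this file's INTENT, dag-lead DEDUP-323 (3) HOLD-FOR-SWAP; swapped as asked: one import, the sub-index token).  This is the N16 slot in the
# currency a prover of [B8] Thm 4 ∕ Prop 3 at the pinned members and of [B7]'s leaf bounds discharges
# (cell `pub-ymgap`, HUMAN RULING D-0062 Track A, R134 seat `pub-ymgap-dag-n27-c` (s2) gen 9; K3⁷ `SpineGivenEndpointR13SepCoPH` = stmt-QuantumFields-20544, `--kind proof --supports 20544 --as helper`;
# COUNT-NEUTRAL; `N`-generic, reading-generic (`w1`, `ℓ₃`, `ne2`, `ne1` parameters), NO Theses import — the item-facing face is ONE application of leaf A §4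
# `spineGivenEndpointR13SepCoPH_of_spine_rec13CCoPHOn` at `Rg := Node00.unityNondeg₁₃H 2`, `N = 2` at the call site)

WHAT IS KERNEL-CHECKED ([bookkeeping]; 0 `def`, 0 `sorry`; each theorem ONE application of XLᶜᵒᵖᴴ `spine_rec13CCoPH(On)_at_readingOfRecord₁₃CoPH` with dag-n16-e's line in the N16 slot and
dag-n22-e 6″ᶜᵒᵖᴴ's dictionary `s_Nxx_readingOfRecord₁₃CoPH_iff` ∕ 5″ᶜᵒᵖᴴ's `s_Nxx_rRec₁₃CoPHOn_iff` unfolding the other rate slots):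
* §1 `spine_rec13CCoPH_at_readingOfRecord₁₃CoPH_of_window_linear` — CANONICAL HOME ⇒ `Spine ₁₃CCoPH`.
* §2 `spine_rec13CCoPHOn_at_readingOfRecord₁₃CoPH_of_window_linear` — REGIME HOME, any `Rg` ⇒ `Spine (IsRecordOfRecord₁₃CCoPHOn Rg)`; at `Rg := Node00.unityNondeg₁₃H N` RR-2's CN class.

HONEST FRAMING.  COMPOSITE-node bookkeeping BY NAME: `Thm4Body`, `Prop3Body`, `LeafH3sup`, the letter lines, NE1′, NE2, NE5, NE9, (D4), NE7b, NE7c, the extraction clause and NE7's core edge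
are DISPLAYED hypotheses (0∕1 at the ₁₃ reading today — N05 ∕ N07 are NOT discharged here; the window-linear line is dag-n16-e's cell knit of N05's and N07's typed interfaces at the
pinned members, NOT a proof of [B8] Thm 4 ∕ Prop 3, asserted for no family); the reading `w1`, the letters `ℓ₃`, `ne2`, `ne1`, `len`, `c₁ … c'` are PARAMETERS; nothing of Bałaban's asserted or instantiated; no `Provisos₁₃CoPH` inhabitant
claimed (K0⁷ open); N16 ∕ N27 NOT discharged; K3⁷ NOT claimed; counts UNMOVED (typed 28∕28 · discharged 5∕27, A 5∕28); one finite four-torus programme at fixed `ε` — NOT ℝ⁴, NOT infinite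
volume, NOT OS, NOT a mass gap, NOT Clay.  No decl below carries a cite tag.
-/

noncomputable section

open scoped BigOperators Matrix Matrix.Norms.L2Operator
open NormedSpace

namespace Summit.QuantumFields.YangMills.Theorems.BalabanUVNodesN27SpineRecord

open Literature.MathematicalPhysics.QuantumFieldTheory.Balaban1983to89
open Literature.MathematicalPhysics.QuantumFieldTheory.Balaban1983to89.T4Continuum
open B7Prop1Explicit B7Prop2Explicit
open B7Prop3Flat (c3)
open B8LeafModelZd (ZdIdx)
open B8LeafModelZd3 (zdGF3)
open T4ContinuumYM4Torus (ForSmallCouplings)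
open Summit.QuantumFields.BalabanUV.T4Continuum
open Summit.QuantumFields.BalabanUV.T4Continuum.Spine
open BlockAverageCurrent (curConst)
open NE3RightInverseSupLetters (frameC)
open NE3.LeafIndexSockets (LeafH3sup)
open YMDAG.UVSplit
open Node00 (Stage13HParams datumOfRecord₁₃CoPH IsRecordOfRecord₁₃CCoPH IsDatumOfRecord₁₃CCoPH NE3Letters₁₁ NE2Objects₁₁ ne3ConstLayerOfRecord₁₁ ne3NperOfRecord₁₁ ne3DomOfRecord₁₁)
open Summit.QuantumFields.YangMills.BalabanUVNodes.N16Regime (radiusOfRecord constOfRecord)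
open Summit.QuantumFields.YangMills.BalabanUVNodes.N16LinesAllTorusAtRecord13CoPH (s_N16_readingOfRecord₁₃CoPH_of_window_linear_allTorus s_N16_readingOfRecord₁₃CoPHOn_of_window_linear_allTorus)

variable {N : ℕ} [NeZero N] (cr : SpineReading₁₃CoPH N)
  (w1 : (F : T4Family) → (θ : Stage13HParams F N) → Node00.W1.ReadingData F (Node00.MatA N) θ.τ9.M) (ℓ₃ : T4Family → NE3Letters₁₁)
  (ne2 : (F : T4Family) → Stage13HParams F N → (ℕ → ℝ) → List (ULoop F) → ℕ → NE2Objects₁₁)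
  (ne1 : (F : T4Family) → Stage13HParams F N → (ℕ → ℝ) → List (ULoop F) → NE1pCarriers)

section WindowLinear

variable
  -- N05's constants, per family; the averaging letter in N05's window and N07's leaf letters, per family (module 20 §4 ∕ module 21 §2, verbatim)
  {len : T4Family → Site 4 → ℝ} {c₁ c₁' B₁' cP C₂ B₀β : T4Family → ℝ} {inp : T4Family → B8.B9Inputs} {α b' c' : T4Family → ℝ}
  (hlen : ∀ (F : T4Family) (v : Site 4), 0 < len F v → 1 ≤ len F v) (hlen1 : ∀ (F : T4Family) (μ : Fin 4), len F (e μ) = 1)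
  (hB₁' : ∀ F, 0 < B₁' F) (hBB : ∀ F : T4Family, 5 * ((4 : ℕ) : ℝ) * F.L * (inp F).B₀ ≤ B₁' F) (hc₁' : ∀ F, 0 < c₁' F)
  (hwin : ∀ (F : T4Family) (α₀ α₁ : ℝ), 0 < α₀ → 0 < α₁ → α₀ + α₁ ≤ c₁' F →
    α₀ + α₁ ≤ c₁ F ∧ C0 4 * (2 * α₀) ≤ 1 / 3 ∧ 4 * α₀ ≤ c2' 4 F.L ∧ 16 * (B₁' F * (α₀ + α₁)) ≤ 1 ∧
    Real.exp (4 * (800 * (((4 : ℕ) : ℝ) + 1) ^ 2 * (((4 : ℕ) : ℝ) + 4)) * α₀) * (1 + 8 * (131072 * (((4 : ℕ) : ℝ) + 1) ^ 2) * (B₁' F * (α₀ + α₁))) ≤ 2 ∧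
    2 * (B₁' F * (α₀ + α₁)) ≤ c3 4 F.L ∧ ((4 : ℕ) : ℝ) * F.L * α₁ ≤ 1 / 8 ∧ α₀ ≤ cP F ∧ α₁ ≤ cP F ∧ B₁' F * (α₀ + α₁) ≤ cP F ∧
    2 * (B₁' F * (α₀ + α₁)) ^ 2 + 20 * ((4 : ℕ) : ℝ) * α₀ * (B₁' F * (α₀ + α₁)) + 2 * C₂ F * (B₁' F * (α₀ + α₁)) ^ 2 ≤ α₀ + α₁)
  (hα : ∀ F, 0 < α F) (hα1 : ∀ F, α F ≤ c₁' F / 177)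
  (hα2 : ∀ F : T4Family, α F ≤ (ℓ₃ F).Λ₁ / (1770 * (5 * ((4 : ℕ) : ℝ) * F.L * (inp F).B₀) + 1))
  (hα3 : ∀ F : T4Family, α F ≤ c2' 4 F.L / 2)
  (hα4 : ∀ F : T4Family, α F ≤ 1 / ((23040 * (4 : ℝ) ^ 4 * (frameC 4 F.L + 4) ^ 3 + 12) * (1 + curConst 4 F.L) + 1))
  (hα5 : ∀ F, α F ≤ 1 / 10 ^ 9)
  (hg : ∀ F, 0 < (ℓ₃ F).g) (hε0 : ∀ F, 0 < (ℓ₃ F).ε) (hε : ∀ F, (ℓ₃ F).ε < α F)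
  (hΛ₁r : ∀ F : T4Family, (ℓ₃ F).Λ₁ ≤ radiusOfRecord N F.L (ne3NperOfRecord₁₁ F 0 0))
  (hb : ∀ F, 0 ≤ (ℓ₃ F).b ∧ (ℓ₃ F).b ≤ (ℓ₃ F).ε / 2) (hC : ∀ F : T4Family, constOfRecord N F.L (ne3NperOfRecord₁₁ F 0 0) (ℓ₃ F).g ≤ (ℓ₃ F).C)
  (hΛ₂' : ∀ F : T4Family, 177 * α F * (5 * ((4 : ℕ) : ℝ) * F.L * B₀β F + 5 * ((4 : ℕ) : ℝ) * F.L * (inp F).B₀) ≤ (ℓ₃ F).Λ₂')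
  (hb' : ∀ F, 0 ≤ b' F ∧ b' F ≤ α F / 2048) (hc' : ∀ F, 0 ≤ c' F ∧ c' F ≤ α F / 24)

include hlen hlen1 hB₁' hBB hc₁' hwin hα hα1 hα2 hα3 hα4 hα5 hg hε0 hε hΛ₁r hb hC hΛ₂' hb' hc'

/-! ## §1 The canonical home at the reading of record, N16 in the WINDOW-LINEAR currency -/

/-- **N27 = B5 AT THE STAGE-13 `CoPH` RECORD FROM THE STUBS AT THE CANONICAL HOME OF THE READING OF RECORD — N17 ELIMINATED, N16 FROM N05's `Thm4Body` ∕ `Prop3Body` AND N07's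
`LeafH3sup` ONCE PER FAMILY** (XLᶜᵒᵖᴴ `spine_rec13CCoPH_at_readingOfRecord₁₃CoPH` with `h16` supplied by dag-n16-e's 36ᴴ `s_N16_readingOfRecord₁₃CoPH_of_window_linear_allTorus`, hypothesis VERBATIM:
for every family carrying a Stage-13 datum of record, [B8] Thm 4's body and Prop 3's body on the PINNED ALL-TORUS proper sub-family (`Ω ≡ univ`, diagonal `Λs` ∕ `Λb`, `η = L⁻ᵏ`) of the `Z^d` leaf model `zdGF3 (M_N ℂ) F.L 1 (len F)` with N05's
letters `c₁ F, B₁' F, cP F, C₂ F, inp F, B₀β F`, and N07's `LeafH3sup 4 F.L (2·L^m) (ℓ₃ F).ε (b' F) (c' F)` at RR-1's data of record; the 21 LETTER LINES of the section are hypotheses).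
The other slots as XLᶜᵒᵖᴴ §1 unfolded: NE1′ on `ne1`, NE2 on `ne2` at `h.params`, NE5 ∕ NE9 ∕ (D4) on `u3OfRecord₁₃ h.params.toStage13Params ((w1 F h.params).u3Objects h.params.γ) k`,
spine side N20 ∕ N21 ∕ extraction at `SRec₁₃CoPH cr`, home-keyed N19′ edge.  Every hypothesis 0∕1 today. [bookkeeping] -/
theorem spine_rec13CCoPH_at_readingOfRecord₁₃CoPH_of_window_linear
    (h14 : ∀ (F : T4Family) (D : Datum F N) (h : IsDatumOfRecord₁₃CCoPH F N D) (g₀ : ℕ → ℝ) (os : List (ULoop F)), N14At (ne1 F h.params g₀ os))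
    (h15 : ∀ (F : T4Family) (D : Datum F N) (h : IsDatumOfRecord₁₃CCoPH F N D) (g₀ : ℕ → ℝ) (os : List (ULoop F)) (k : ℕ),
      N15At (ne2OfRecord₁₁ (ne2 F h.params g₀ os k)))
    -- N16 ⟸ WINDOW-LINEAR content once per family carrying a datum of record (dag-n16-e 36ᴴ `s_N16_readingOfRecord₁₃CoPH_of_window_linear_allTorus`, verbatim — N05's conjuncts at the PINNED ALL-TORUS proper sub-index)
    (h16 : ∀ (F : T4Family), (∃ D : Datum F N, IsDatumOfRecord₁₃CCoPH F N D) →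
      letI : CStarAlgebra (Matrix (Fin N) (Fin N) ℂ) := {}
      B8.Thm4Body (c₁ F) (B₁' F) (fun i : {i : ZdIdx 4 F.L // (∀ j, i.Ω j = Set.univ) ∧ (∀ m j, i.Λs m j = {_y | j = m}) ∧ (∀ m j, i.Λb m j = {_c | j = m}) ∧ i.η = ((F.L : ℝ)⁻¹) ^ i.k} => (zdGF3 (Matrix (Fin N) (Fin N) ℂ) F.L 1 (len F) i.1).toGFData) ∧
        B8.Prop3Body (cP F) 4 (F.L : ℝ) (C₂ F) (inp F) (B₀β F)
          (fun i : {i : ZdIdx 4 F.L // (∀ j, i.Ω j = Set.univ) ∧ (∀ m j, i.Λs m j = {_y | j = m}) ∧ (∀ m j, i.Λb m j = {_c | j = m}) ∧ i.η = ((F.L : ℝ)⁻¹) ^ i.k} => (zdGF3 (Matrix (Fin N) (Fin N) ℂ) F.L 1 (len F) i.1).toGFData2) ∧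
        LeafH3sup 4 F.L (ne3NperOfRecord₁₁ F 0 0) (ℓ₃ F).ε (b' F) (c' F) (ne3DomOfRecord₁₁ F N 0 0))
    (h18 : ∀ (F : T4Family) (D : Datum F N) (h : IsDatumOfRecord₁₃CCoPH F N D) (k : ℕ), N18At (u3OfRecord₁₃ h.params.toStage13Params ((w1 F h.params).u3Objects h.params.γ) k))
    (h22 : ∀ (F : T4Family) (D : Datum F N) (h : IsDatumOfRecord₁₃CCoPH F N D) (k : ℕ), N22At (u3OfRecord₁₃ h.params.toStage13Params ((w1 F h.params).u3Objects h.params.γ) k))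
    (hD4 : ∀ (F : T4Family) (D : Datum F N) (h : IsDatumOfRecord₁₃CCoPH F N D) (k : ℕ), ReadOutAt D (u3OfRecord₁₃ h.params.toStage13Params ((w1 F h.params).u3Objects h.params.γ) k))
    (hx' : S_N27x (fun F D w => IsRecordOfRecord₁₃CCoPH F N D w) (SRec₁₃CoPH cr)) (h20 : S_N20 (SRec₁₃CoPH cr)) (h21 : S_N21 (SRec₁₃CoPH cr))
    (h19 : ∀ (F : T4Family) (θ : Stage13HParams F N) (hP : θ.Provisos₁₃CoPH F N), θ.Admissible F N → ∀ (g₀ : ℕ → ℝ) (os : List (ULoop F))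
      (h : IsDatumOfRecord₁₃CCoPH F N (datumOfRecord₁₃CoPH F N θ hP)) (k : ℕ),
      RatesAt (datumOfRecord₁₃CoPH F N θ hP) (rateCarriersOfRecord₁₃CoPH (readingOfRecord₁₃CoPH w1 ℓ₃ ne2 ne1) F h.params h.provisos g₀ os k) → letI := (cr F θ hP g₀ os).dec
        ∃ δ : ℕ → ℝ, NE7.Core (cr F θ hP g₀ os).l₀ (cr F θ hP g₀ os).vol (cr F θ hP g₀ os).T (cr F θ hP g₀ os).Bad
          (fun K t τ => (cr F θ hP g₀ os).A K t τ - (cr F θ hP g₀ os).shA K t τ) (fun K t τ => (cr F θ hP g₀ os).B K t τ - (cr F θ hP g₀ os).shB K t τ) δ ∧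
          Summable δ) :
    Spine (N := N) fun F D w => IsRecordOfRecord₁₃CCoPH F N D w :=
  spine_rec13CCoPH_at_readingOfRecord₁₃CoPH cr w1 ℓ₃ ne2 ne1 ((s_N14_readingOfRecord₁₃CoPH_iff w1 ℓ₃ ne2 ne1).mpr h14)
    ((s_N15_readingOfRecord₁₃CoPH_iff w1 ℓ₃ ne2 ne1).mpr h15)
    (s_N16_readingOfRecord₁₃CoPH_of_window_linear_allTorus (ℓ := ℓ₃) (w1 := w1) (ne2 := ne2) (ne1 := ne1) hlen hlen1 hB₁' hBB hc₁' hwin hα hα1 hα2 hα3 hα4 hα5 hg hε0 hε hΛ₁r hb hC hΛ₂' hb' hc'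
      h16)
    ((s_N18_readingOfRecord₁₃CoPH_iff w1 ℓ₃ ne2 ne1).mpr h18) ((s_N22_readingOfRecord₁₃CoPH_iff w1 ℓ₃ ne2 ne1).mpr h22)
    ((s_D4_readingOfRecord₁₃CoPH_iff w1 ℓ₃ ne2 ne1).mpr hD4) hx' h20 h21 h19

/-! ## §2 The regime-restricted home at the reading of record, any regime `Rg`, N16 in the WINDOW-LINEAR currency -/

/-- **N27 = B5 AT THE REGIME RECORD CLASS `IsRecordOfRecord₁₃CCoPHOn F N Rg` FROM THE STUBS AT THE REGIME HOME OF THE READING OF RECORD, ANY `Rg` — N17 ELIMINATED, N16 FROM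
N05's `Thm4Body` ∕ `Prop3Body` AND N07's `LeafH3sup` ONCE PER GUARDED FAMILY** (XLᶜᵒᵖᴴ `spine_rec13CCoPHOn_at_readingOfRecord₁₃CoPH` with `h16` ⟸ dag-n16-e's
36ᴴ `s_N16_readingOfRecord₁₃CoPHOn_of_window_linear_allTorus` — the same content asked of the families carrying an admissible tuple with provisos IN THE REGIME, VERBATIM).  NE1′ ∕ NE2 ∕ NE5 ∕
NE9 ∕ (D4) at θ for tuples in the regime; spine side N20 ∕ N21 at `SRec₁₃CoPHOn cr Rg`, the guarded keyed extraction clause, the same-tuple N19′ edge (as XXXIXᶜᵒᵖᴴ).  At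
`Rg := Node00.unityNondeg₁₃H 2`, `N = 2` THE ITEM is leaf A §4 `spineGivenEndpointR13SepCoPH_of_spine_rec13CCoPHOn` of this.  Every hypothesis 0∕1 today. [bookkeeping] -/
theorem spine_rec13CCoPHOn_at_readingOfRecord₁₃CoPH_of_window_linear (Rg : (F : T4Family) → Stage13HParams F N → Prop)
    (h14 : ∀ (F : T4Family) (θ : Stage13HParams F N), θ.Provisos₁₃CoPH F N → Rg F θ → θ.Admissible F N → ∀ (g₀ : ℕ → ℝ) (os : List (ULoop F)),
      N14At (ne1 F θ g₀ os))
    (h15 : ∀ (F : T4Family) (θ : Stage13HParams F N), θ.Provisos₁₃CoPH F N → Rg F θ → θ.Admissible F N → ∀ (g₀ : ℕ → ℝ) (os : List (ULoop F)) (k : ℕ),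
      N15At (ne2OfRecord₁₁ (ne2 F θ g₀ os k)))
    -- N16 ⟸ WINDOW-LINEAR content once per family carrying an admissible tuple with provisos in the regime (dag-n16-e 36ᴴ `s_N16_readingOfRecord₁₃CoPHOn_of_window_linear_allTorus`, verbatim — N05's conjuncts at the PINNED ALL-TORUS proper sub-index)
    (h16 : ∀ (F : T4Family), (∃ θ : Stage13HParams F N, θ.Provisos₁₃CoPH F N ∧ Rg F θ ∧ θ.Admissible F N) →
      letI : CStarAlgebra (Matrix (Fin N) (Fin N) ℂ) := {}
      B8.Thm4Body (c₁ F) (B₁' F) (fun i : {i : ZdIdx 4 F.L // (∀ j, i.Ω j = Set.univ) ∧ (∀ m j, i.Λs m j = {_y | j = m}) ∧ (∀ m j, i.Λb m j = {_c | j = m}) ∧ i.η = ((F.L : ℝ)⁻¹) ^ i.k} => (zdGF3 (Matrix (Fin N) (Fin N) ℂ) F.L 1 (len F) i.1).toGFData) ∧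
        B8.Prop3Body (cP F) 4 (F.L : ℝ) (C₂ F) (inp F) (B₀β F)
          (fun i : {i : ZdIdx 4 F.L // (∀ j, i.Ω j = Set.univ) ∧ (∀ m j, i.Λs m j = {_y | j = m}) ∧ (∀ m j, i.Λb m j = {_c | j = m}) ∧ i.η = ((F.L : ℝ)⁻¹) ^ i.k} => (zdGF3 (Matrix (Fin N) (Fin N) ℂ) F.L 1 (len F) i.1).toGFData2) ∧
        LeafH3sup 4 F.L (ne3NperOfRecord₁₁ F 0 0) (ℓ₃ F).ε (b' F) (c' F) (ne3DomOfRecord₁₁ F N 0 0))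
    (h18 : ∀ (F : T4Family) (θ : Stage13HParams F N), θ.Provisos₁₃CoPH F N → Rg F θ → θ.Admissible F N → ∀ k : ℕ,
      N18At (u3OfRecord₁₃ θ.toStage13Params ((w1 F θ).u3Objects θ.γ) k))
    (h22 : ∀ (F : T4Family) (θ : Stage13HParams F N), θ.Provisos₁₃CoPH F N → Rg F θ → θ.Admissible F N → ∀ k : ℕ,
      N22At (u3OfRecord₁₃ θ.toStage13Params ((w1 F θ).u3Objects θ.γ) k))
    (hD4 : ∀ (F : T4Family) (θ : Stage13HParams F N) (hP : θ.Provisos₁₃CoPH F N), Rg F θ → θ.Admissible F N → ∀ k : ℕ,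
      ReadOutAt (datumOfRecord₁₃CoPH F N θ hP) (u3OfRecord₁₃ θ.toStage13Params ((w1 F θ).u3Objects θ.γ) k))
    (h20 : S_N20 (SRec₁₃CoPHOn cr Rg)) (h21 : S_N21 (SRec₁₃CoPHOn cr Rg))
    (hx : ∀ (F : T4Family) (θ : Stage13HParams F N) (hP : θ.Provisos₁₃CoPH F N), Rg F θ → θ.Admissible F N →
      B16.EndStatementBPrinted (datumOfRecord₁₃CoPH F N θ hP).C → DagBinding.EndpointExistence (datumOfRecord₁₃CoPH F N θ hP).C.toB12 →
        ForSmallCouplings (datumOfRecord₁₃CoPH F N θ hP) fun g₀ => ∀ os : List (ULoop F),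
          0 < (cr F θ hP g₀ os).l₀ ∧ 0 < (cr F θ hP g₀ os).vol ∧
          (∀ (K : ℕ) (t : ℝ), |t| ≤ (cr F θ hP g₀ os).l₀ →
            T4GenFunBounds.schemeZ ((datumOfRecord₁₃CoPH F N θ hP).scheme g₀) os ((cr F θ hP g₀ os).K₀ + K) t =
              ∑ τ ∈ (cr F θ hP g₀ os).T K, (cr F θ hP g₀ os).A K t τ) ∧
          (∀ (K : ℕ) (t : ℝ), |t| ≤ (cr F θ hP g₀ os).l₀ →
            T4GenFunBounds.schemeZ ((datumOfRecord₁₃CoPH F N θ hP).scheme g₀) os ((cr F θ hP g₀ os).K₀ + K + 1) t =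
              ∑ τ ∈ (cr F θ hP g₀ os).T K, (cr F θ hP g₀ os).B K t τ))
    (h19 : ∀ (F : T4Family) (θ : Stage13HParams F N) (hP : θ.Provisos₁₃CoPH F N), Rg F θ → θ.Admissible F N → ∀ (g₀ : ℕ → ℝ) (os : List (ULoop F)),
      (∀ k : ℕ, RatesAt (datumOfRecord₁₃CoPH F N θ hP) (rateCarriersOfRecord₁₃CoPH (readingOfRecord₁₃CoPH w1 ℓ₃ ne2 ne1) F θ hP g₀ os k)) → letI := (cr F θ hP g₀ os).dec
        ∃ δ : ℕ → ℝ, NE7.Core (cr F θ hP g₀ os).l₀ (cr F θ hP g₀ os).vol (cr F θ hP g₀ os).T (cr F θ hP g₀ os).Bad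
          (fun K t τ => (cr F θ hP g₀ os).A K t τ - (cr F θ hP g₀ os).shA K t τ) (fun K t τ => (cr F θ hP g₀ os).B K t τ - (cr F θ hP g₀ os).shB K t τ) δ ∧
          Summable δ) :
    Spine (N := N) fun F D w => Node00.IsRecordOfRecord₁₃CCoPHOn F N Rg D w :=
  spine_rec13CCoPHOn_at_readingOfRecord₁₃CoPH cr w1 ℓ₃ ne2 ne1 Rg
    ((s_N14_rRec₁₃CoPHOn_iff _ Rg).mpr fun F θ hP hRg hθ g₀ os => h14 F θ hP hRg hθ g₀ os)
    ((s_N15_rRec₁₃CoPHOn_iff _ Rg).mpr fun F θ hP hRg hθ g₀ os k => h15 F θ hP hRg hθ g₀ os k)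
    (s_N16_readingOfRecord₁₃CoPHOn_of_window_linear_allTorus (Rg := Rg) (ℓ := ℓ₃) (w1 := w1) (ne2 := ne2) (ne1 := ne1) hlen hlen1 hB₁' hBB hc₁' hwin hα hα1 hα2 hα3 hα4 hα5 hg hε0 hε hΛ₁r hb hC hΛ₂' hb' hc'
      h16)
    ((s_N18_rRec₁₃CoPHOn_iff _ Rg).mpr fun F θ hP hRg hθ _ _ k => h18 F θ hP hRg hθ k)
    ((s_N22_rRec₁₃CoPHOn_iff _ Rg).mpr fun F θ hP hRg hθ _ _ k => h22 F θ hP hRg hθ k)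
    ((s_D4_rRec₁₃CoPHOn_iff _ Rg).mpr fun F θ hP hRg hθ _ _ k => hD4 F θ hP hRg hθ k) h20 h21 hx h19

end WindowLinear

end Summit.QuantumFields.YangMills.Theorems.BalabanUVNodesN27SpineRecord

end
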